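import Literature.MathematicalPhysics.QuantumFieldTheory.Balaban1983to89.BlockAveragingTwoLevel
import Literature.MathematicalPhysics.QuantumFieldTheory.Balaban1983to89.BlockAveragingFederbush

/-!
# `Balaban1983to89.B12ContourMultiplicity252` — [Balaban1987RG1] p. 252: every contour of `𝐆(y, x)` arises from the
# same number of orderings of the axes (the identification of the tree's ordering-indexed families with print's
# set-indexed ones)

CITATION HEADER (lean-in-tree rule 2026-08-18).  T. Bałaban, *Renormalization group approach to lattice gauge field
theories. I*, Commun. Math. Phys. **109** (1987) 249–301 [Balaban1987RG1], p. 252 [PDF 4] (render `…-p004-x2.png` read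
first-hand, unit `lit-balaban-r09` gen 40), verbatim: *"If x − y = Σ_{μ=1}^d δn_μe_μ (δ is a lattice spacing, n_μ an
integer such that |n_μ| ≦ L−1/2), then we construct contours of 𝐆(y, x) in the following way: take a permutation
{π(1), π(2), …} of indices μ with nonzero numbers n_μ, next take |n_{π(1)}| bonds in the direction sign n_{π(1)}e_{π(1)}
starting at y, |n_{π(2)}| bonds in the direction sign n_{π(2)}e_{π(2)} starting at y + δn_{π(1)}e_{π(1)}, and so on. We
define 𝐆(y, x) as the family of contours generated by all such permuations."*  The averages (0.4) p. 253 and (0.11)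
p. 253 are taken over the SET `𝐆(y, x)` with the weights `|𝐆(c₋, x)|⁻¹`, `|𝐆(c₊, x′)|⁻¹` resp. as the argument set of
the group mean `M`.
Statement-level skeleton of published theorems with citation tags; proofs where landed; nothing here is a claim about
the Yang–Mills mass gap.

WHAT THIS FILE PROVES (kernel combinatorics; no definition of the series, no new named fact).  The tree indexes the
contour families by ALL orderings `σ : Equiv.Perm (Fin d)` of the `d` axes — `BlockAveraging` (`T4Continuum.stairWord σ n`,
the uniform family over `Idx`, docstring: *"each contour of G(y,x) then occurs the same number d!/|G(y,x)| of times, so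
the uniform weight over orderings is the printed weight 1/|G(y,x)|"*), `BlockAveragingTwoLevel.cVar` (DIVERGENCE
D-pv26g2.3 (ii)) and the `ℤᵈ` lineage `B12ContourAverage253.Tavg` (D-b12g23.1 (b)) — a claim the tree stated in prose
only.  Here it is a theorem:
* `stairWord_eq_stairRuns_axesSeq`: the staircase word of an ordering `σ` depends only on `axesSeq n σ`, the sub-sequence of
  the axes `μ` with `n_μ ≠ 0` in the order `σ` lists them (print's "permutation {π(1), π(2), …} of indices μ with nonzero
  numbers n_μ"); `stairWord_eq_iff`: two orderings give the same contour IFF these sub-sequences coincide (the word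
  determines the sequence of its non-empty runs: `stairRuns_injective`);
* `card_fiber_eq`: for any two orderings `σ, σ'` the sets of orderings producing the contour of `σ`, resp. of `σ'`, are
  EQUINUMEROUS (left multiplication by a permutation `matchPerm` of the axes that fixes the zero set of `n` and carries
  `axesSeq n σ` to `axesSeq n σ'`);
* `sum_perm_eq_mult_smul_sum_contours`, `card_contours_mul_mult`, `avg_perm_eq_avg_contours`: consequently, for every
  function `f` of contours with values in an additive commutative monoid / a real vector space,
  `Σ_{σ} f(Γ^σ) = m • Σ_{Γ ∈ 𝐆} f(Γ)` with `|𝐆|·m = d!`, i.e. `(1/d!) Σ_σ f(Γ^σ) = (1/|𝐆|) Σ_{Γ∈𝐆} f(Γ)` — the uniform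
  weight over orderings IS print's weight `|𝐆(y,x)|⁻¹` over contours, for each of the two factors of (0.4) and for the
  argument multiset of (0.11).
* §4, FEDERBUSH'S MEAN (0.10) IS INVARIANT UNDER UNIFORM REPETITION of its argument family (`fedM_comp_of_fiber_const`,
  by the local uniqueness `FederbushMean.fedM_unique` of `BlockAveragingFederbush`: the repeated family has the same
  normalised equation (0.10)), lifted to the `Setup.GroupAverage` inhabitant `federbushU` over arbitrary finite index types
  (`federbushU_avg_comp_of_fiber_const`); hence THE IDENTIFICATION of the torus-side (0.11)
  `BlockAveragingTwoLevel.cVar federbushU U y n = M({U(Γ^σ)}_{σ ∈ S_d})` (DIVERGENCE D-pv26g2.3 (ii): indexed by orderings)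
  WITH PRINT'S SET-INDEXED `𝐔(y, x) = M({U(Γ)}_{Γ ∈ 𝐆(y,x)})` for print's own `M` = (0.10) («a definition which is
  equivalent to the one given by Federbush») on `G = U(N)`: `cVar_federbushU_eq_avg_contours`.
* §5 (v1.1, gen 41, APPEND-ONLY; §§1–4 byte-identical): THE TWO-FACTOR FAMILY OF (0.4) — the double sum
  `Σ_{Γ∈𝐆(c₋,x)} Σ_{Γ′∈𝐆(c₊,x′)} |𝐆|⁻¹|𝐆|⁻¹ …` of (0.4) p. 253 against the tree's uniform family over pairs of orderings
  `(σ, σ′)` (`BlockAveraging.Idx`): `sum_perm_perm_eq_smul_sum_contours` (`Σ_{σ,σ′} f(Γ^σ, Γ′^{σ′}) = (m·m′) • Σ_{Γ,Γ′} f`) and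
  `avg_perm_perm_eq_avg_contours` (`(d!)⁻² Σ_{σ,σ′} = |𝐆(c₋,x)|⁻¹|𝐆(c₊,x′)|⁻¹ Σ_{Γ,Γ′}`) — two applications of §3.
-/

namespace Literature.MathematicalPhysics.QuantumFieldTheory.Balaban1983to89.B12ContourMultiplicity252

open Literature.MathematicalPhysics.QuantumFieldTheory.Balaban1983to89
open T4Continuum
open _root_.Finset

variable {d : ℕ}

/-! ## §1 The sub-sequence of non-zero axes and the staircase word -/

/-- Print's *"permutation {π(1), π(2), …} of indices μ with nonzero numbers n_μ"* read off an ordering `σ` of ALL axes: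
the axes with `n_μ ≠ 0` in the order in which `σ` lists them. [cite: Balaban1987RG1, (0.3) p.252] -/
def axesSeq (n : Fin d → ℤ) (σ : Equiv.Perm (Fin d)) : List (Fin d) :=
  ((List.finRange d).map σ).filter (fun a => decide (n a ≠ 0))

/-- Membership in the sub-sequence = non-zero offset. [folklore] -/
private theorem mem_axesSeq {n : Fin d → ℤ} {σ : Equiv.Perm (Fin d)} {a : Fin d} : a ∈ axesSeq n σ ↔ n a ≠ 0 := by
  simp only [axesSeq, List.mem_filter, List.mem_map, List.mem_finRange, true_and, decide_eq_true_eq,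
    and_iff_right_iff_imp]
  exact fun _ => ⟨σ.symm a, σ.apply_symm_apply a⟩

/-- The sub-sequence has no duplicates. [folklore] -/
private theorem nodup_axesSeq (n : Fin d → ℤ) (σ : Equiv.Perm (Fin d)) : (axesSeq n σ).Nodup :=
  (List.Nodup.map σ.injective (List.nodup_finRange d)).filter _

/-- Members of the sub-sequence have non-zero offset. [folklore] -/
private theorem ne_zero_of_mem_axesSeq {n : Fin d → ℤ} {σ : Equiv.Perm (Fin d)} {a : Fin d} (h : a ∈ axesSeq n σ) :
    n a ≠ 0 := mem_axesSeq.mp h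

/-- A zero run is empty. [folklore] -/
private theorem axisRun_zero (μ : Fin d) : axisRun μ 0 = [] := by simp [axisRun]

/-- A non-zero run starts with its letter: `axisRun μ k = (μ, 0 ≤ k) :: replicate (|k| − 1) (μ, 0 ≤ k)`. [folklore] -/
private theorem axisRun_eq_cons {μ : Fin d} {k : ℤ} (hk : k ≠ 0) :
    axisRun μ k = (μ, decide (0 ≤ k)) :: List.replicate (k.natAbs - 1) (μ, decide (0 ≤ k)) := by
  have h : k.natAbs = (k.natAbs - 1) + 1 := by
    have := Int.natAbs_pos.mpr hk
    omega
  rw [axisRun, h, List.replicate_succ]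
  simp

/-- The staircase through a list of axes ignores the axes with `n_μ = 0` (empty runs). [folklore] -/
private theorem stairRuns_eq_filter (n : Fin d → ℤ) :
    ∀ l : List (Fin d), stairRuns n l = stairRuns n (l.filter (fun a => decide (n a ≠ 0)))
  | [] => rfl
  | a :: as => by
    by_cases h : n a = 0
    · simp [stairRuns, h, axisRun_zero, stairRuns_eq_filter n as]
    · simp [stairRuns, h, stairRuns_eq_filter n as]

/-- **The contour of an ordering depends only on the sub-sequence of non-zero axes**: `Γ^σ = stairRuns n (axesSeq n σ)`.
[cite: Balaban1987RG1, (0.3) p.252] -/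
theorem stairWord_eq_stairRuns_axesSeq (σ : Equiv.Perm (Fin d)) (n : Fin d → ℤ) :
    stairWord σ n = stairRuns n (axesSeq n σ) := by
  rw [stairWord, stairRuns_eq_filter]; rfl

/-- **A staircase word determines the sequence of its (non-empty) runs**: on lists of axes all with `n_μ ≠ 0`,
`stairRuns n` is injective. [folklore] -/
private theorem stairRuns_injective {n : Fin d → ℤ} :
    ∀ {l₁ l₂ : List (Fin d)}, (∀ a ∈ l₁, n a ≠ 0) → (∀ a ∈ l₂, n a ≠ 0) →
      stairRuns n l₁ = stairRuns n l₂ → l₁ = l₂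
  | [], [], _, _, _ => rfl
  | [], b :: bs, _, h₂, h => by
    have hb : n b ≠ 0 := h₂ b (by simp)
    simp [stairRuns, axisRun_eq_cons hb] at h
  | a :: as, [], h₁, _, h => by
    have ha : n a ≠ 0 := h₁ a (by simp)
    simp [stairRuns, axisRun_eq_cons ha] at h
  | a :: as, b :: bs, h₁, h₂, h => by
    have ha : n a ≠ 0 := h₁ a (by simp)
    have hb : n b ≠ 0 := h₂ b (by simp)
    have h' : (a, decide (0 ≤ n a)) :: (List.replicate ((n a).natAbs - 1) (a, decide (0 ≤ n a)) ++ stairRuns n as)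
        = (b, decide (0 ≤ n b)) :: (List.replicate ((n b).natAbs - 1) (b, decide (0 ≤ n b)) ++ stairRuns n bs) := by
      simpa [stairRuns, axisRun_eq_cons ha, axisRun_eq_cons hb] using h
    obtain ⟨hab, htl⟩ := List.cons.inj h'
    have hab' : a = b := (Prod.mk.inj hab).1
    subst hab'
    have hrest : stairRuns n as = stairRuns n bs := List.append_cancel_left htl
    rw [stairRuns_injective (fun x hx => h₁ x (by simp [hx])) (fun x hx => h₂ x (by simp [hx])) hrest]

/-- **Two orderings give the same contour iff they list the non-zero axes in the same order.** [cite: Balaban1987RG1, (0.3) p.252] -/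
theorem stairWord_eq_iff (n : Fin d → ℤ) (σ τ : Equiv.Perm (Fin d)) :
    stairWord σ n = stairWord τ n ↔ axesSeq n σ = axesSeq n τ := by
  rw [stairWord_eq_stairRuns_axesSeq, stairWord_eq_stairRuns_axesSeq]
  exact ⟨stairRuns_injective (fun _ h => ne_zero_of_mem_axesSeq h) (fun _ h => ne_zero_of_mem_axesSeq h),
    fun h => by rw [h]⟩

/-! ## §2 Relabelling the non-zero axes: all fibres are equinumerous -/

/-- Left multiplication by a permutation `ρ` of the axes preserving the zero set of `n` relabels the sub-sequence:
`axesSeq n (ρσ) = ρ(axesSeq n σ)`. [folklore] -/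
private theorem axesSeq_mul {n : Fin d → ℤ} (ρ σ : Equiv.Perm (Fin d)) (hρ : ∀ a, n (ρ a) ≠ 0 ↔ n a ≠ 0) :
    axesSeq n (ρ * σ) = (axesSeq n σ).map ρ := by
  simp only [axesSeq, Equiv.Perm.coe_mul]
  rw [← List.map_map, List.filter_map]
  congr 1
  apply List.filter_congr
  intro a _
  simp only [Function.comp_apply]
  by_cases h : n a = 0
  · have : n (ρ a) = 0 := by
      by_contra h'
      exact ((hρ a).mp h') h
    simp [h, this]
  · simp [h, (hρ a).mpr h]

/-- The two sub-sequences of any two orderings have the same length (both enumerate the non-zero axes without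
repetition). [folklore] -/
private theorem length_axesSeq_eq (n : Fin d → ℤ) (σ τ : Equiv.Perm (Fin d)) :
    (axesSeq n σ).length = (axesSeq n τ).length := by
  classical
  rw [← List.toFinset_card_of_nodup (nodup_axesSeq n σ), ← List.toFinset_card_of_nodup (nodup_axesSeq n τ)]
  congr 1
  ext a
  simp [List.mem_toFinset, mem_axesSeq]

/-- The enumeration `Fin |axesSeq| ≃ {a // n a ≠ 0}` given by an ordering. [folklore] -/
noncomputable def axesEquiv (n : Fin d → ℤ) (σ : Equiv.Perm (Fin d)) :
    Fin (axesSeq n σ).length ≃ {a : Fin d // n a ≠ 0} :=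
  ((nodup_axesSeq n σ).getEquiv (axesSeq n σ)).trans
    (Equiv.subtypeEquivRight (fun _ => mem_axesSeq))

/-- The enumeration is `List.get`. [folklore] -/
private theorem axesEquiv_apply_val (n : Fin d → ℤ) (σ : Equiv.Perm (Fin d)) (i : Fin (axesSeq n σ).length) :
    ((axesEquiv n σ i : {a : Fin d // n a ≠ 0}) : Fin d) = (axesSeq n σ).get i := rfl

/-- **The matching permutation**: the permutation of the axes that carries the `i`-th non-zero axis of `σ` to the
`i`-th non-zero axis of `τ` and fixes every axis with `n_μ = 0`. [folklore] -/
noncomputable def matchPerm (n : Fin d → ℤ) (σ τ : Equiv.Perm (Fin d)) : Equiv.Perm (Fin d) :=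
  Equiv.Perm.subtypeCongr
    (((axesEquiv n σ).symm.trans (finCongr (length_axesSeq_eq n σ τ))).trans (axesEquiv n τ))
    (Equiv.refl _)

/-- The matching permutation on a non-zero axis. [folklore] -/
private theorem matchPerm_apply_of_ne {n : Fin d → ℤ} (σ τ : Equiv.Perm (Fin d)) {a : Fin d} (h : n a ≠ 0) :
    matchPerm n σ τ a
      = ((((axesEquiv n σ).symm.trans (finCongr (length_axesSeq_eq n σ τ))).trans (axesEquiv n τ)) ⟨a, h⟩ :
          {a : Fin d // n a ≠ 0}) := by
  unfold matchPerm
  rw [Equiv.Perm.subtypeCongr.apply, dif_pos h]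

/-- The matching permutation fixes the zero axes. [folklore] -/
private theorem matchPerm_apply_of_eq {n : Fin d → ℤ} (σ τ : Equiv.Perm (Fin d)) {a : Fin d} (h : n a = 0) :
    matchPerm n σ τ a = a := by
  unfold matchPerm
  rw [Equiv.Perm.subtypeCongr.apply, dif_neg (not_not.mpr h)]
  rfl

/-- The matching permutation preserves the zero set of `n`. [folklore] -/
private theorem matchPerm_preserves {n : Fin d → ℤ} (σ τ : Equiv.Perm (Fin d)) (a : Fin d) :
    n (matchPerm n σ τ a) ≠ 0 ↔ n a ≠ 0 := by
  by_cases h : n a = 0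
  · rw [matchPerm_apply_of_eq σ τ h]
  · rw [matchPerm_apply_of_ne σ τ h]
    exact ⟨fun _ => h, fun _ => Subtype.prop (p := fun b => n b ≠ 0) _⟩

/-- The matching permutation carries `axesSeq n σ` to `axesSeq n τ`. [folklore] -/
private theorem map_matchPerm_axesSeq (n : Fin d → ℤ) (σ τ : Equiv.Perm (Fin d)) :
    (axesSeq n σ).map (matchPerm n σ τ) = axesSeq n τ := by
  apply List.ext_get
  · simpa using length_axesSeq_eq n σ τ
  · intro i h₁ h₂
    have h₁' : i < (axesSeq n σ).length := by simpa using h₁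
    simp only [List.get_eq_getElem, List.getElem_map]
    have hmem : n ((axesSeq n σ)[i]) ≠ 0 := ne_zero_of_mem_axesSeq (List.getElem_mem h₁')
    rw [matchPerm_apply_of_ne σ τ hmem]
    have hsymm : (axesEquiv n σ).symm ⟨(axesSeq n σ)[i], hmem⟩ = ⟨i, h₁'⟩ := by
      rw [Equiv.symm_apply_eq]
      apply Subtype.ext
      simp [axesEquiv_apply_val, List.get_eq_getElem]
    simp only [Equiv.trans_apply, hsymm, finCongr_apply]
    simp [axesEquiv_apply_val, List.get_eq_getElem]

/-- The fibre of the contour of `σ`: all orderings producing the same contour. [cite: Balaban1987RG1, (0.3) p.252] -/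
def fiber (n : Fin d → ℤ) (σ : Equiv.Perm (Fin d)) : Finset (Equiv.Perm (Fin d)) :=
  Finset.univ.filter (fun τ => stairWord τ n = stairWord σ n)

/-- Membership in the fibre. [folklore] -/
private theorem mem_fiber {n : Fin d → ℤ} {σ τ : Equiv.Perm (Fin d)} : τ ∈ fiber n σ ↔ stairWord τ n = stairWord σ n := by
  simp [fiber]

/-- Left multiplication by the matching permutation maps the fibre of `σ` into the fibre of `σ'`. [folklore] -/
private theorem mul_mem_fiber {n : Fin d → ℤ} (σ σ' : Equiv.Perm (Fin d)) {τ : Equiv.Perm (Fin d)} (hτ : τ ∈ fiber n σ) :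
    matchPerm n σ σ' * τ ∈ fiber n σ' := by
  rw [mem_fiber, stairWord_eq_iff] at hτ ⊢
  rw [axesSeq_mul _ _ (matchPerm_preserves σ σ'), hτ, map_matchPerm_axesSeq]

/-- One fibre injects into any other. [folklore] -/
private theorem card_fiber_le (n : Fin d → ℤ) (σ σ' : Equiv.Perm (Fin d)) : (fiber n σ).card ≤ (fiber n σ').card :=
  Finset.card_le_card_of_injOn (fun τ => matchPerm n σ σ' * τ) (fun _ hτ => mul_mem_fiber σ σ' hτ)
    (fun _ _ _ _ h => mul_left_cancel h)

/-- **EQUAL MULTIPLICITIES**: any two contours of `𝐆(y, x)` arise from the same number of orderings of the axes.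
[cite: Balaban1987RG1, (0.3) p.252] -/
theorem card_fiber_eq (n : Fin d → ℤ) (σ σ' : Equiv.Perm (Fin d)) : (fiber n σ).card = (fiber n σ').card :=
  le_antisymm (card_fiber_le n σ σ') (card_fiber_le n σ' σ)

/-! ## §3 The set `𝐆(y, x)` of contours and the weights -/

/-- **The SET `𝐆(y, x)` of shortest staircase contours** for the offset `n = (x − y)/δ` ("the family of contours generated
by all such permuations"), as the finite set of the distinct staircase words. [cite: Balaban1987RG1, (0.3) p.252] -/
def contours (n : Fin d → ℤ) : Finset (List (Letter d)) :=
  Finset.univ.image (fun σ : Equiv.Perm (Fin d) => stairWord σ n)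

/-- Every ordering produces a member of `𝐆(y, x)`. [cite: Balaban1987RG1, (0.3) p.252] -/
theorem stairWord_mem_contours (n : Fin d → ℤ) (σ : Equiv.Perm (Fin d)) : stairWord σ n ∈ contours n :=
  Finset.mem_image_of_mem _ (Finset.mem_univ σ)

/-- `𝐆(y, x)` is non-empty (the contour of the identity ordering). [cite: Balaban1987RG1, (0.3) p.252] -/
theorem contours_nonempty (n : Fin d → ℤ) : (contours n).Nonempty := ⟨_, stairWord_mem_contours n 1⟩

/-- `|𝐆(y, x)| > 0`. [cite: Balaban1987RG1, (0.3) p.252] -/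
theorem card_contours_pos (n : Fin d → ℤ) : 0 < (contours n).card := (contours_nonempty n).card_pos

/-- The common multiplicity `m(n)` = the number of orderings producing any fixed contour. [cite: Balaban1987RG1, (0.3) p.252] -/
def mult (n : Fin d → ℤ) : ℕ := (fiber n 1).card

/-- Every contour of `𝐆(y, x)` has exactly `m` orderings producing it. [cite: Balaban1987RG1, (0.3) p.252] -/
theorem card_filter_eq_mult (n : Fin d → ℤ) {w : List (Letter d)} (hw : w ∈ contours n) :
    (Finset.univ.filter (fun τ : Equiv.Perm (Fin d) => stairWord τ n = w)).card = mult n := by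
  obtain ⟨σ, -, rfl⟩ := Finset.mem_image.mp hw
  exact card_fiber_eq n σ 1

/-- `m > 0`. [cite: Balaban1987RG1, (0.3) p.252] -/
theorem mult_pos (n : Fin d → ℤ) : 0 < mult n :=
  Finset.card_pos.mpr ⟨1, by simp [fiber]⟩

/-- **`|𝐆(y, x)| · m = d!`**: the orderings are partitioned into `|𝐆|` fibres of the common size `m`.
[cite: Balaban1987RG1, (0.3) p.252] -/
theorem card_contours_mul_mult (n : Fin d → ℤ) :
    (contours n).card * mult n = Nat.factorial d := by
  classical
  have h : (Finset.univ : Finset (Equiv.Perm (Fin d))).card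
      = ∑ w ∈ contours n, (Finset.univ.filter (fun τ : Equiv.Perm (Fin d) => stairWord τ n = w)).card :=
    Finset.card_eq_sum_card_image _ _
  rw [Finset.card_univ, Fintype.card_perm, Fintype.card_fin] at h
  rw [h, Finset.sum_congr rfl (fun w hw => card_filter_eq_mult n hw), Finset.sum_const, smul_eq_mul]

/-- **SUMS OVER ORDERINGS = `m` × SUMS OVER CONTOURS**: for every function `f` of contours (values in any additive
commutative monoid), `Σ_{σ ∈ S_d} f(Γ^σ) = m • Σ_{Γ ∈ 𝐆(y,x)} f(Γ)`. [cite: Balaban1987RG1, (0.4) p.253] -/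
theorem sum_perm_eq_mult_smul_sum_contours {M : Type*} [AddCommMonoid M] (n : Fin d → ℤ) (f : List (Letter d) → M) :
    ∑ σ : Equiv.Perm (Fin d), f (stairWord σ n) = mult n • ∑ w ∈ contours n, f w := by
  classical
  rw [Finset.sum_comp, Finset.smul_sum]
  refine Finset.sum_congr rfl (fun w hw => ?_)
  rw [card_filter_eq_mult n hw]

/-- **THE PRINTED WEIGHTS**: the uniform average over the `d!` orderings equals print's average with the weight
`|𝐆(y, x)|⁻¹` over the distinct contours — `(1/d!) Σ_σ f(Γ^σ) = |𝐆|⁻¹ Σ_{Γ∈𝐆} f(Γ)` (each factor `Σ_{Γ∈𝐆(c_∓,·)} |𝐆|⁻¹ …`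
of (0.4); the argument family of `M` in (0.11)). [cite: Balaban1987RG1, (0.4) p.253] -/
theorem avg_perm_eq_avg_contours {V : Type*} [AddCommGroup V] [Module ℝ V] (n : Fin d → ℤ) (f : List (Letter d) → V) :
    ((Nat.factorial d : ℝ)⁻¹) • ∑ σ : Equiv.Perm (Fin d), f (stairWord σ n)
      = (((contours n).card : ℝ)⁻¹) • ∑ w ∈ contours n, f w := by
  rw [sum_perm_eq_mult_smul_sum_contours, ← card_contours_mul_mult n]
  have hc : ((contours n).card : ℝ) ≠ 0 := Nat.cast_ne_zero.mpr (card_contours_pos n).ne'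
  have hm : ((mult n : ℕ) : ℝ) ≠ 0 := Nat.cast_ne_zero.mpr (mult_pos n).ne'
  rw [Nat.cast_mul, ← Nat.cast_smul_eq_nsmul ℝ (mult n), smul_smul, mul_inv, mul_assoc, inv_mul_cancel₀ hm, mul_one]

/-- Real-valued form: `(1/d!) Σ_σ f(Γ^σ) = (1/|𝐆|) Σ_{Γ ∈ 𝐆} f(Γ)`. [cite: Balaban1987RG1, (0.4) p.253] -/
theorem avg_perm_eq_avg_contours_real (n : Fin d → ℤ) (f : List (Letter d) → ℝ) :
    (∑ σ : Equiv.Perm (Fin d), f (stairWord σ n)) / Nat.factorial d = (∑ w ∈ contours n, f w) / (contours n).card := by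
  have h := avg_perm_eq_avg_contours n f
  simp only [smul_eq_mul] at h
  rw [div_eq_inv_mul, div_eq_inv_mul]
  exact h


/-! ## §4 Federbush's mean (0.10) under uniform repetition; the identification of (0.11) -/

section Fibres

/-- A sum over a map all of whose fibres have the same cardinality `c` is `c` times the sum over the target. [folklore] -/
private theorem sum_comp_of_fiber_const {ι κ M : Type*} [Fintype ι] [Fintype κ] [DecidableEq ι] [AddCommMonoid M]
    (g : κ → ι) (c : ℕ) (hc : ∀ i, (Finset.univ.filter (fun k => g k = i)).card = c) (f : ι → M) :
    ∑ k, f (g k) = c • ∑ i, f i := by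
  rw [← Finset.sum_fiberwise Finset.univ g (fun k => f (g k)), Finset.smul_sum]
  refine Finset.sum_congr rfl (fun i _ => ?_)
  rw [Finset.sum_congr rfl (fun k hk => by rw [(Finset.mem_filter.mp hk).2] : ∀ k ∈ Finset.univ.filter (fun k => g k = i),
    f (g k) = f i), Finset.sum_const, hc i]

/-- Conjugating a map by bijections of source and target preserves the fibre cardinalities. [folklore] -/
private theorem card_filter_comp_equiv {ι κ ι' κ' : Type*} [Fintype κ] [Fintype κ'] [DecidableEq ι] [DecidableEq ι']
    (g : κ → ι) (e₁ : ι ≃ ι') (e₂ : κ ≃ κ') (i' : ι') :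
    (Finset.univ.filter (fun k' => e₁ (g (e₂.symm k')) = i')).card
      = (Finset.univ.filter (fun k => g k = e₁.symm i')).card := by
  rw [← Fintype.card_subtype, ← Fintype.card_subtype]
  refine Fintype.card_congr (Equiv.subtypeEquiv e₂.symm (fun k' => ?_))
  rw [Equiv.apply_eq_iff_eq_symm_apply]

end Fibres

section Federbush

open scoped Matrix.Norms.L2Operator
open FederbushMean MatrixLog

variable {N : Type*} [Fintype N] [DecidableEq N] [Nonempty N]

omit [Nonempty N] in
/-- **FEDERBUSH'S GROUP AVERAGE IS INVARIANT UNDER UNIFORM REPETITION**: if every member of a unitary family on the guard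
is repeated the same number `c` of times (precomposition with a map `g` all of whose fibres have cardinality `c`), the mean
(0.10) does not change — the repeated family has the equation `c · Σ_j log(U_j M⁻¹) = 0`, and the mean is the locally
unique solution (`fedM_unique`). [cite: Balaban1987RG1, (0.10) p.253] -/
theorem fedM_comp_of_fiber_const {m m' : ℕ} {δ : ℝ} {U : Fin (m + 1) → Matrix N N ℂ}
    (hU : ∀ j, U j ∈ Matrix.unitaryGroup N ℂ) (hδ : δ ≤ 1 / 100) (h : ∀ i k, ‖U i * star (U k) - 1‖ < δ)
    (g : Fin (m' + 1) → Fin (m + 1)) (c : ℕ) (hc : ∀ j, (Finset.univ.filter (fun j' => g j' = j)).card = c) :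
    fedM δ (U ∘ g) = fedM δ U := by
  have hUg : ∀ j', (U ∘ g) j' ∈ Matrix.unitaryGroup N ℂ := fun j' => hU (g j')
  have hg : ∀ i k, ‖(U ∘ g) i * star ((U ∘ g) k) - 1‖ < δ := fun i k => h (g i) (g k)
  symm
  apply fedM_unique hUg hδ hg
  · have hA := norm_fedM_mul_star_sub_one_le hU hδ h
    have hB : ‖U 0 * star (U (g 0)) - 1‖ ≤ δ := (h 0 (g 0)).le
    have hprod : fedM δ U * star (U (g 0)) = (fedM δ U * star (U 0)) * (U 0 * star (U (g 0))) := by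
      rw [mul_assoc, ← mul_assoc (star (U 0)), Unitary.star_mul_self_of_mem (hU 0), one_mul]
    show ‖fedM δ U * star (U (g 0)) - 1‖ ≤ 2 / 25
    rw [hprod]
    have hAB := norm_mul_sub_one_le hA hB
    have hδ0 : 0 ≤ δ := (norm_nonneg _).trans hB
    linarith
  · show ∑ j', mlog ((U ∘ g) j' * star (fedM δ U)) = 0
    have key := sum_mlog_mul_star_fedM hδ h
    have hsum := sum_comp_of_fiber_const g c hc (fun j => mlog (U j * star (fedM δ U)))
    simp only [Function.comp_apply] at hsum ⊢
    rw [hsum, key, smul_zero]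

/-- The same for the `Setup.GroupAverage` inhabitant `federbushU` over arbitrary nonempty finite index types: the average of
a uniformly repeated admissible family equals the average of the family. [cite: Balaban1987RG1, (0.10) p.253] -/
theorem federbushU_avg_comp_of_fiber_const {ι κ : Type*} [Fintype ι] [Nonempty ι] [Fintype κ] [Nonempty κ]
    [DecidableEq ι] (W : ι → Matrix.unitaryGroup N ℂ) (hW : (federbushU (n := N)).Adm W)
    (g : κ → ι) (c : ℕ) (hc : ∀ i, (Finset.univ.filter (fun k => g k = i)).card = c) :
    (federbushU (n := N)).avg (W ∘ g) = (federbushU (n := N)).avg W := by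
  classical
  unfold GroupAverage.avg
  apply Subtype.ext
  show fedM (1 / 100) (fun j => (((W ∘ g) ∘ (LoopAverage.enum κ).symm) j : Matrix N N ℂ))
    = fedM (1 / 100) (fun j => ((W ∘ (LoopAverage.enum ι).symm) j : Matrix N N ℂ))
  set U : Fin (Fintype.card ι - 1 + 1) → Matrix N N ℂ := fun j => ((W ((LoopAverage.enum ι).symm j)) : Matrix N N ℂ)
    with hUdef
  have hU : ∀ j, U j ∈ Matrix.unitaryGroup N ℂ := fun j => (W _).2
  have hsmall : ∀ i k, ‖U i * star (U k) - 1‖ < 1 / 100 :=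
    (familySmall_U_iff _).1 ((federbushU (n := N)).familySmall_of_adm hW)
  have hrew : (fun j => (((W ∘ g) ∘ (LoopAverage.enum κ).symm) j : Matrix N N ℂ))
      = U ∘ (fun j' => LoopAverage.enum ι (g ((LoopAverage.enum κ).symm j'))) := by
    funext j'
    simp [hUdef]
  rw [hrew]
  exact fedM_comp_of_fiber_const hU le_rfl hsmall _ c
    (fun j => by rw [card_filter_comp_equiv g (LoopAverage.enum ι) (LoopAverage.enum κ) j]; exact hc _)

open BlockAveragingTwoLevel in
/-- **THE IDENTIFICATION OF (0.11)**: for print's own group mean — Federbush's (0.10), the tree's `federbushU` on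
`G = U(N)` — the torus-side averaged contour variable `BlockAveragingTwoLevel.cVar federbushU U y n = M({U(Γ^σ)}_{σ ∈ S_d})`,
indexed by ALL orderings of the axes (DIVERGENCE D-pv26g2.3 (ii)), EQUALS print's set-indexed
`𝐔(y, x) = M({U(Γ)}_{Γ ∈ 𝐆(y, x)})` — on families of small diameter («sets … with sufficiently small diameters», the
admissibility guard of `M`). [cite: Balaban1987RG1, (0.11) p.253] -/
theorem cVar_federbushU_eq_avg_contours {P : Params} {j : ℕ} (U : GaugeField P j (Matrix.unitaryGroup N ℂ))
    (y : Site P (j + 1)) (n : Fin P.d → ℤ)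
    (hAdm : (federbushU (n := N)).Adm (fun w : ↥(contours n) => holAt U (walk (emb y) (w : List (Letter P.d))))) :
    haveI : Nonempty ↥(contours n) := (contours_nonempty n).to_subtype
    cVar federbushU U y n
      = (federbushU (n := N)).avg (fun w : ↥(contours n) => holAt U (walk (emb y) (w : List (Letter P.d)))) := by
  classical
  haveI : Nonempty ↥(contours n) := (contours_nonempty n).to_subtype
  have hg : stairHol U y n
      = (fun w : ↥(contours n) => holAt U (walk (emb y) (w : List (Letter P.d))))
          ∘ (fun σ => (⟨stairWord σ n, stairWord_mem_contours n σ⟩ : ↥(contours n))) := rfl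
  unfold cVar
  rw [hg]
  refine federbushU_avg_comp_of_fiber_const _ hAdm _ (mult n) (fun w => ?_)
  rw [← card_filter_eq_mult n w.2]
  congr 1
  ext σ
  simp [Subtype.ext_iff]

end Federbush

/-! ## §5 (v1.1) The two-factor family of (0.4): pairs of orderings vs pairs of contours -/

section TwoFactor

/-- **(0.4)'s DOUBLE SUM OVER ORDERINGS = `m·m′` × THE DOUBLE SUM OVER CONTOURS**: for every function `f` of a pair of contours
(values in any additive commutative monoid) and offsets `n` (of `x` from `c₋`), `n′` (of `x′` from `c₊`),
`Σ_{σ} Σ_{σ′} f(Γ^σ_n, Γ^{σ′}_{n′}) = (m(n)·m(n′)) • Σ_{Γ ∈ 𝐆(n)} Σ_{Γ′ ∈ 𝐆(n′)} f(Γ, Γ′)` — the tree's uniform family over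
`(σ, σ′)` (`BlockAveraging.Idx`, `loopWord … σ σ′`) against print's `Σ_{Γ∈𝐆(c₋,x)} Σ_{Γ′∈𝐆(c₊,x′)}` of (0.4); §3 applied in
each factor. [cite: Balaban1987RG1, (0.4) p.253] -/
theorem sum_perm_perm_eq_smul_sum_contours {M : Type*} [AddCommMonoid M] (n n' : Fin d → ℤ)
    (f : List (Letter d) → List (Letter d) → M) :
    ∑ σ : Equiv.Perm (Fin d), ∑ σ' : Equiv.Perm (Fin d), f (stairWord σ n) (stairWord σ' n')
      = (mult n * mult n') • ∑ w ∈ contours n, ∑ w' ∈ contours n', f w w' := by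
  rw [sum_perm_eq_mult_smul_sum_contours n (fun w => ∑ σ' : Equiv.Perm (Fin d), f w (stairWord σ' n'))]
  simp_rw [sum_perm_eq_mult_smul_sum_contours n' (f _)]
  rw [← Finset.smul_sum, smul_smul]

/-- **THE PRINTED WEIGHTS OF (0.4), BOTH FACTORS**: the uniform average over the `(d!)²` pairs of orderings equals print's
average with the weights `|𝐆(c₋, x)|⁻¹ |𝐆(c₊, x′)|⁻¹` over the pairs of distinct contours —
`(d!)⁻¹(d!)⁻¹ Σ_{σ,σ′} f(Γ^σ, Γ′^{σ′}) = |𝐆|⁻¹|𝐆′|⁻¹ Σ_{Γ∈𝐆} Σ_{Γ′∈𝐆′} f(Γ, Γ′)` (the factor `L^{−d} Σ_{x∈B(c₋)}` of (0.4) is the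
same on both sides). [cite: Balaban1987RG1, (0.4) p.253] -/
theorem avg_perm_perm_eq_avg_contours {V : Type*} [AddCommGroup V] [Module ℝ V] (n n' : Fin d → ℤ)
    (f : List (Letter d) → List (Letter d) → V) :
    (((Nat.factorial d : ℝ)⁻¹ * (Nat.factorial d : ℝ)⁻¹)) •
        ∑ σ : Equiv.Perm (Fin d), ∑ σ' : Equiv.Perm (Fin d), f (stairWord σ n) (stairWord σ' n')
      = ((((contours n).card : ℝ)⁻¹ * ((contours n').card : ℝ)⁻¹)) •
        ∑ w ∈ contours n, ∑ w' ∈ contours n', f w w' := by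
  have inner : ∀ w : List (Letter d),
      ((Nat.factorial d : ℝ)⁻¹) • ∑ σ' : Equiv.Perm (Fin d), f w (stairWord σ' n')
        = (((contours n').card : ℝ)⁻¹) • ∑ w' ∈ contours n', f w w' :=
    fun w => avg_perm_eq_avg_contours n' (f w)
  calc (((Nat.factorial d : ℝ)⁻¹ * (Nat.factorial d : ℝ)⁻¹)) •
        ∑ σ : Equiv.Perm (Fin d), ∑ σ' : Equiv.Perm (Fin d), f (stairWord σ n) (stairWord σ' n')
      = ((Nat.factorial d : ℝ)⁻¹) • ∑ σ : Equiv.Perm (Fin d),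
          ((Nat.factorial d : ℝ)⁻¹) • ∑ σ' : Equiv.Perm (Fin d), f (stairWord σ n) (stairWord σ' n') := by
        rw [mul_smul, Finset.smul_sum]
    _ = ((Nat.factorial d : ℝ)⁻¹) • ∑ σ : Equiv.Perm (Fin d),
          (((contours n').card : ℝ)⁻¹) • ∑ w' ∈ contours n', f (stairWord σ n) w' := by
        simp_rw [inner]
    _ = (((contours n).card : ℝ)⁻¹) • ∑ w ∈ contours n,
          (((contours n').card : ℝ)⁻¹) • ∑ w' ∈ contours n', f w w' :=
        avg_perm_eq_avg_contours n (fun w => (((contours n').card : ℝ)⁻¹) • ∑ w' ∈ contours n', f w w')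
    _ = ((((contours n).card : ℝ)⁻¹ * ((contours n').card : ℝ)⁻¹)) •
          ∑ w ∈ contours n, ∑ w' ∈ contours n', f w w' := by
        rw [mul_smul, ← Finset.smul_sum]

/-- Real-valued form: `(Σ_{σ,σ′} f) / (d!)² = (Σ_{Γ,Γ′} f) / (|𝐆| |𝐆′|)`. [cite: Balaban1987RG1, (0.4) p.253] -/
theorem avg_perm_perm_eq_avg_contours_real (n n' : Fin d → ℤ) (f : List (Letter d) → List (Letter d) → ℝ) :
    (∑ σ : Equiv.Perm (Fin d), ∑ σ' : Equiv.Perm (Fin d), f (stairWord σ n) (stairWord σ' n'))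
        / ((Nat.factorial d : ℝ) * Nat.factorial d)
      = (∑ w ∈ contours n, ∑ w' ∈ contours n', f w w') / ((contours n).card * (contours n').card : ℝ) := by
  have h := avg_perm_perm_eq_avg_contours n n' f
  simp only [smul_eq_mul] at h
  rw [div_eq_inv_mul, div_eq_inv_mul, mul_inv, mul_inv]
  exact h

end TwoFactor

end Literature.MathematicalPhysics.QuantumFieldTheory.Balaban1983to89.B12ContourMultiplicity252
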